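import Literature.MathematicalPhysics.QuantumFieldTheory.Balaban1983to89.B15BasicStep

/-!
# `Balaban1983to89.B15Bounds199` — [Balaban1989LargeFieldI] p. 199: the four displayed estimate chains between (1.96)
# and (1.98) (the field bound `< 23d²ε_h` on the layer `Σ`, the two `ℍ`-bounds `< αε_j`, and the units inequality
# `ε_kη² ≤ … ≤ L^{−(k−j)}ε_j(L^{k−j}η)²`) as kernel arithmetic under the located hypotheses

statement-level skeleton of published theorems with citation tags; proofs where landed; nothing here is a claim about
the Yang–Mills mass gap.

CITATION HEADER (lean-in-tree rule 2026-08-18).  T. Bałaban, *Large field renormalization. I. The basic step of the 𝐑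
operation*, Commun. Math. Phys. **122**, 175–202 (1989), doi:10.1007/BF01257412, bib `Balaban1989LargeFieldI` (cell
paper B15; PDF held `paper:balaban1989-cmp122-large-field-i`, journal page = PDF page + 174; p. 199 READ AS AN IMAGE on
the x2 render `run/shared/lean/pub/pub-balaban/b2b-balaban-ref1/pages/1989-cmp122-large-field-I/…-p025-x2.png`).  The
paper is a manuscript under adjudication by the audit cell `pub-balaban`; NOTHING printed in it is asserted here as a
fact: each displayed chain is proved as an implication between real numbers, with every input the text names made an
explicit hypothesis (flow relations of [III], the definition of `δ′`, located smallness / largeness of `N`, `R_h`,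
`p₁/p₀`).  WHAT IS REPRODUCED: SKELETON row `B15.Eq1.97` (the p. 199 passage) and the inputs it names (rows
`B15.Claim@192`, `B15.Eq1.94`), unit `lit-balaban-r12` gen 7 (reader/typer and fold owner of block B15, Phase 2 in own
block), HOME `run/shared/lean/pub/lit-balaban/` (`lit-balaban-r12/ROWS-B15.md`).  Companion arithmetic of the same kind:
`B15.BasicStep.bound200a/b/c` (p. 200), `restrN194_exponent` ((1.94)).

THE PRINTED CHAINS (verbatim, p. 199 [PDF 25]).  (A) *"This field can be bounded by 22d² max{1, L^{−2N}N^{1/2}O(1)B₃B₅M⁵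
(1 + β₀)}ε_h + 2δ′_k ≦ 22d²ε_h + 2(1 + β₀)N^{1/2}(A₁p₁(g_h))/(A₀p₀(g_h)) ε_h < 23d²ε_h."*  (B) *"The ℍ-function in the
expansion can be bounded on the domain Z″_{j+1}∖Z″_j for h < j < k, … by B₃exp(−δ(M/M₁)(j − h))exp(−½δMR_h)23d²ε_h ≦
23d²B₃(1 + β₀)²(1 + (j − h)^{β₀})exp(−(j − h))exp(−R_h)ε_j < αε_j."*  (C) *"The corresponding ℍ-function can be bounded
on the same domains as above by B₃δ′_k ≦ B₃(1 + β₀)(1 + (k − j)^{1/2})(A₁p₁(g_j))/(A₀p₀(g_j)) ε_j < αε_j."*  (D) *"using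
the inequality ε_kη² ≦ (1 + β₀)(k − j)^{1/2}L^{−2(k−j)}ε_j(L^{k−j}η)² ≦ L^{−(k−j)}ε_j(L^{k−j}η)²"*.

WHAT IS TYPED AND PROVED (0 `sorry`, no `def`, no new `Prop`).  Letters: `r_h = (A₁p₁(g_h))/(A₀p₀(g_h))` (the ratio
`δ′/ε` of p. 183), `n = j − h` resp. `k − j` a natural number.
* `chainA_le`, `chainA_lt` — (A): the `≦` from `max{1, …} = 1` (the restriction `L^{−2N}N^{1/2}O(1)B₃B₅M⁵(1+β₀) ≤ 1` on
  `N`, cf. (1.94)) and `δ′_k ≤ (1+β₀)N^{1/2}r_hε_h` (p. 192 cumulation + p. 183); the `<` from the located smallness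
  `2(1+β₀)N^{1/2}r_h < d²` (p₁/p₀ small).
* `one_add_rpow_mul_exp_neg_le` — `(1 + n^{β₀})e^{−n} ≤ 1` for `n ∈ ℕ`, `0 < β₀ ≤ 1` (the elementary fact behind (B));
  `chainB_le`, `chainB_lt` — (B): the `≦` from `δ(M/M₁) ≥ 1` (p. 186 chose `≥ 2`), `½δM ≥ 1`, `R_h ≥ 0` and the reverse
  flow relation `ε_h ≤ (1+β₀)²(1+(j−h)^{β₀})ε_j` (hypothesis); the `<` from the located largeness `23d²B₃(1+β₀)²e^{−R_h}
  < α` of `R_h`.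
* `chainC_le`, `chainC_lt` — (C): from `δ′_k ≤ r_kε_k`, `r_k ≤ r_j`, `ε_k ≤ (1+β₀)(1+(k−j)^{1/2})ε_j` ([III] (2.8)) and
  the located smallness `B₃(1+β₀)(1+(k−j)^{1/2})r_j < α`.
* `sqrt_le_two_pow_div`, `chainD` — (D): the first `≦` from `ε_k ≤ (1+β₀)(k−j)^{1/2}ε_j` (as printed; `k > j`), the
  second PROVED for `L ≥ 2`, `0 ≤ β₀ ≤ ½`, `k − j ≥ 1` (`(1+β₀)(k−j)^{1/2} ≤ L^{k−j}`).
-/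

namespace Literature.MathematicalPhysics.QuantumFieldTheory.Balaban1983to89.B15Bounds199

open Real

/-! ## (A) the field bound on the layer `Σ` -/

/-- **(A), the `≦`**: with `max{1, X} = 1` (`X ≤ 1`, the restriction on `N`) and `δ′_k ≤ (1+β₀)N^{1/2}r_hε_h`:
`22d²max{1,X}ε_h + 2δ′_k ≤ 22d²ε_h + 2(1+β₀)N^{1/2}r_hε_h`. [cite: Balaban1989LargeFieldI, p.199] -/
theorem chainA_le {d X εh δk β₀ sqN r : ℝ} (hX : X ≤ 1) (hδ : δk ≤ (1 + β₀) * sqN * r * εh) :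
    22 * d ^ 2 * max 1 X * εh + 2 * δk ≤ 22 * d ^ 2 * εh + 2 * (1 + β₀) * sqN * r * εh := by
  rw [max_eq_left hX, mul_one]
  linarith

/-- **(A), the `<`**: with the located smallness `2(1+β₀)N^{1/2}r_h < d²` (p₁/p₀ small) and `ε_h > 0`:
`22d²ε_h + 2(1+β₀)N^{1/2}r_hε_h < 23d²ε_h`. [cite: Balaban1989LargeFieldI, p.199] -/
theorem chainA_lt {d εh β₀ sqN r : ℝ} (hsmall : 2 * (1 + β₀) * sqN * r < d ^ 2) (hε : 0 < εh) :
    22 * d ^ 2 * εh + 2 * (1 + β₀) * sqN * r * εh < 23 * d ^ 2 * εh := by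
  nlinarith

/-! ## (B) the `ℍ`-bound on `Z″_{j+1}∖Z″_j` -/

/-- `(1 + n^{β₀})e^{−n} ≤ 1` for a natural number `n` and `0 < β₀ ≤ 1` (`n^{β₀} ≤ n` for `n ≥ 1`, `1 + n ≤ e^n`).
[cite: Balaban1989LargeFieldI, p.199] -/
theorem one_add_rpow_mul_exp_neg_le (n : ℕ) {β₀ : ℝ} (hβ₀ : 0 < β₀) (hβ₁ : β₀ ≤ 1) :
    (1 + (n : ℝ) ^ β₀) * exp (-(n : ℝ)) ≤ 1 := by
  have hpow : (n : ℝ) ^ β₀ ≤ n := by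
    rcases Nat.eq_zero_or_pos n with h0 | hpos
    · subst h0; simp [Real.zero_rpow hβ₀.ne']
    · have h1 : (1 : ℝ) ≤ n := by exact_mod_cast hpos
      calc (n : ℝ) ^ β₀ ≤ (n : ℝ) ^ (1 : ℝ) := Real.rpow_le_rpow_of_exponent_le h1 hβ₁
        _ = n := Real.rpow_one _
  have hexp : 1 + (n : ℝ) ≤ exp (n : ℝ) := by linarith [Real.add_one_le_exp (n : ℝ)]
  have hpos : 0 < exp (n : ℝ) := Real.exp_pos _
  rw [Real.exp_neg]
  rw [mul_inv_le_iff₀ hpos, one_mul]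
  linarith

/-- **(B), the `≦`**: with `δ(M/M₁) ≥ 1` (p. 186: *"We choose M large enough, so that δ(M/M₁) ≧ 2"*), `½δM ≥ 1`, `R_h ≥ 0`,
`B₃ ≥ 0`, `ε_j ≥ 0` and the flow relation `ε_h ≤ (1+β₀)²(1+(j−h)^{β₀})ε_j` (hypothesis; [III] (2.5)–(2.8)):
`B₃e^{−δ(M/M₁)(j−h)}e^{−½δMR_h}23d²ε_h ≤ 23d²B₃(1+β₀)²(1+(j−h)^{β₀})e^{−(j−h)}e^{−R_h}ε_j`. [cite: Balaban1989LargeFieldI, p.199] -/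
theorem chainB_le (n : ℕ) {d B₃ δ M M₁ Rh εh εj β₀ : ℝ} (hB₃ : 0 ≤ B₃) (hδM : 1 ≤ δ * (M / M₁))
    (hδM2 : 1 ≤ δ * M / 2) (hRh : 0 ≤ Rh) (hεh : 0 ≤ εh) (hεj : 0 ≤ εj)
    (hflow : εh ≤ (1 + β₀) ^ 2 * (1 + (n : ℝ) ^ β₀) * εj) :
    B₃ * exp (-(δ * (M / M₁) * n)) * exp (-(δ * M / 2 * Rh)) * (23 * d ^ 2) * εh
      ≤ 23 * d ^ 2 * B₃ * (1 + β₀) ^ 2 * (1 + (n : ℝ) ^ β₀) * exp (-(n : ℝ)) * exp (-Rh) * εj := by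
  have hn : (0 : ℝ) ≤ n := Nat.cast_nonneg n
  have h1 : exp (-(δ * (M / M₁) * n)) ≤ exp (-(n : ℝ)) := by
    apply Real.exp_le_exp.mpr; nlinarith
  have h2 : exp (-(δ * M / 2 * Rh)) ≤ exp (-Rh) := by
    apply Real.exp_le_exp.mpr; nlinarith
  have hnb : 0 ≤ (n : ℝ) ^ β₀ := Real.rpow_nonneg hn β₀
  have hbound0 : 0 ≤ (1 + β₀) ^ 2 * (1 + (n : ℝ) ^ β₀) * εj :=
    mul_nonneg (mul_nonneg (sq_nonneg _) (by linarith)) hεj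
  have hA : B₃ * exp (-(δ * (M / M₁) * n)) * exp (-(δ * M / 2 * Rh)) * (23 * d ^ 2)
      ≤ B₃ * exp (-(n : ℝ)) * exp (-Rh) * (23 * d ^ 2) := by
    have := mul_le_mul (mul_le_mul_of_nonneg_left h1 hB₃) h2 (Real.exp_pos _).le
      (mul_nonneg hB₃ (Real.exp_pos _).le)
    exact mul_le_mul_of_nonneg_right this (by positivity)
  have hA'0 : 0 ≤ B₃ * exp (-(n : ℝ)) * exp (-Rh) * (23 * d ^ 2) := by positivity
  calc B₃ * exp (-(δ * (M / M₁) * n)) * exp (-(δ * M / 2 * Rh)) * (23 * d ^ 2) * εh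
      ≤ B₃ * exp (-(n : ℝ)) * exp (-Rh) * (23 * d ^ 2) * ((1 + β₀) ^ 2 * (1 + (n : ℝ) ^ β₀) * εj) :=
        mul_le_mul hA hflow hεh hA'0
    _ = 23 * d ^ 2 * B₃ * (1 + β₀) ^ 2 * (1 + (n : ℝ) ^ β₀) * exp (-(n : ℝ)) * exp (-Rh) * εj := by ring

/-- **(B), the `<`**: with `(1 + (j−h)^{β₀})e^{−(j−h)} ≤ 1` (`one_add_rpow_mul_exp_neg_le`) and the located largeness
`23d²B₃(1+β₀)²e^{−R_h} < α` of `R_h` (`B₃ ≥ 0`, `ε_j > 0`): `23d²B₃(1+β₀)²(1+(j−h)^{β₀})e^{−(j−h)}e^{−R_h}ε_j < αε_j`.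
[cite: Balaban1989LargeFieldI, p.199] -/
theorem chainB_lt (n : ℕ) {d B₃ Rh εj β₀ α : ℝ} (hB₃ : 0 ≤ B₃) (hβ₀ : 0 < β₀) (hβ₁ : β₀ ≤ 1) (hεj : 0 < εj)
    (hlarge : 23 * d ^ 2 * B₃ * (1 + β₀) ^ 2 * exp (-Rh) < α) :
    23 * d ^ 2 * B₃ * (1 + β₀) ^ 2 * (1 + (n : ℝ) ^ β₀) * exp (-(n : ℝ)) * exp (-Rh) * εj < α * εj := by
  have h1 := one_add_rpow_mul_exp_neg_le n hβ₀ hβ₁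
  have hK : 0 ≤ 23 * d ^ 2 * B₃ * (1 + β₀) ^ 2 := by positivity
  have h2 : 23 * d ^ 2 * B₃ * (1 + β₀) ^ 2 * (1 + (n : ℝ) ^ β₀) * exp (-(n : ℝ)) * exp (-Rh)
      ≤ 23 * d ^ 2 * B₃ * (1 + β₀) ^ 2 * exp (-Rh) := by
    have := mul_le_mul_of_nonneg_left h1 (mul_nonneg hK (Real.exp_pos (-Rh)).le)
    calc _ = 23 * d ^ 2 * B₃ * (1 + β₀) ^ 2 * exp (-Rh) * ((1 + (n : ℝ) ^ β₀) * exp (-(n : ℝ))) := by ring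
      _ ≤ 23 * d ^ 2 * B₃ * (1 + β₀) ^ 2 * exp (-Rh) * 1 := this
      _ = _ := by ring
  calc _ ≤ 23 * d ^ 2 * B₃ * (1 + β₀) ^ 2 * exp (-Rh) * εj := mul_le_mul_of_nonneg_right h2 hεj.le
    _ < α * εj := mul_lt_mul_of_pos_right hlarge hεj

/-! ## (C) the `ℍ`-bound for the expansion in `B′` -/

/-- **(C), the `≦`**: with `δ′_k ≤ r_kε_k` (p. 183, `r = (A₁p₁(g))/(A₀p₀(g))`), `r_k ≤ r_j`, `ε_k ≤ (1+β₀)(1+(k−j)^{1/2})ε_j`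
([III] (2.8)), `B₃, ε_k, r_j ≥ 0`: `B₃δ′_k ≤ B₃(1+β₀)(1+(k−j)^{1/2})r_jε_j`. [cite: Balaban1989LargeFieldI, p.199] -/
theorem chainC_le {B₃ δk rk rj εk εj β₀ s : ℝ} (hB₃ : 0 ≤ B₃) (hεk : 0 ≤ εk) (hrj : 0 ≤ rj)
    (hδ : δk ≤ rk * εk) (hr : rk ≤ rj) (hflow : εk ≤ (1 + β₀) * (1 + s) * εj) :
    B₃ * δk ≤ B₃ * (1 + β₀) * (1 + s) * rj * εj := by
  have h1 : δk ≤ rj * εk := hδ.trans (mul_le_mul_of_nonneg_right hr hεk)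
  have h2 : rj * εk ≤ rj * ((1 + β₀) * (1 + s) * εj) := mul_le_mul_of_nonneg_left hflow hrj
  calc B₃ * δk ≤ B₃ * (rj * ((1 + β₀) * (1 + s) * εj)) := mul_le_mul_of_nonneg_left (h1.trans h2) hB₃
    _ = B₃ * (1 + β₀) * (1 + s) * rj * εj := by ring

/-- **(C), the `<`**: with the located smallness `B₃(1+β₀)(1+(k−j)^{1/2})r_j < α` (p₁/p₀ small) and `ε_j > 0`.
[cite: Balaban1989LargeFieldI, p.199] -/
theorem chainC_lt {B₃ rj εj β₀ s α : ℝ} (hsmall : B₃ * (1 + β₀) * (1 + s) * rj < α) (hεj : 0 < εj) :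
    B₃ * (1 + β₀) * (1 + s) * rj * εj < α * εj :=
  mul_lt_mul_of_pos_right hsmall hεj

/-! ## (D) the units inequality -/

/-- `(1 + β₀)(k−j)^{1/2} ≤ L^{k−j}` for `L ≥ 2`, `0 ≤ β₀ ≤ ½`, `k − j ≥ 1` (the elementary fact behind the second
`≦` of (D): `(3/2)√n ≤ (3/2)n ≤ 2^n ≤ L^n`). [cite: Balaban1989LargeFieldI, p.199] -/
theorem sqrt_mul_le_pow (n : ℕ) (hn : 1 ≤ n) {L β₀ : ℝ} (hL : 2 ≤ L) (hβ₀ : 0 ≤ β₀) (hβ : β₀ ≤ 1 / 2) :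
    (1 + β₀) * Real.sqrt n ≤ L ^ n := by
  have hn1 : (1 : ℝ) ≤ n := by exact_mod_cast hn
  have hsqrt : Real.sqrt n ≤ n := by
    rw [Real.sqrt_le_left (by linarith)]
    nlinarith
  have key : ∀ m : ℕ, 2 * (m + 1) ≤ 2 ^ (m + 1) := by
    intro m
    induction m with
    | zero => norm_num
    | succ m ih =>
      have h2 : 2 ≤ 2 ^ (m + 1) := by
        calc 2 = 2 ^ 1 := by norm_num
          _ ≤ 2 ^ (m + 1) := Nat.pow_le_pow_right (by norm_num) (by omega)
      calc 2 * (m + 1 + 1) = 2 * (m + 1) + 2 := by ring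
        _ ≤ 2 ^ (m + 1) + 2 ^ (m + 1) := Nat.add_le_add ih h2
        _ = 2 ^ (m + 1 + 1) := by ring
  have h2n : (2 : ℝ) * n ≤ 2 ^ n := by
    obtain ⟨m, rfl⟩ : ∃ m, n = m + 1 := ⟨n - 1, by omega⟩
    exact_mod_cast key m
  have hL2 : (2 : ℝ) ^ n ≤ L ^ n := by gcongr
  have hs0 : 0 ≤ Real.sqrt n := Real.sqrt_nonneg _
  nlinarith

/-- **(D)**: `ε_kη² ≤ (1+β₀)(k−j)^{1/2}L^{−2(k−j)}ε_j(L^{k−j}η)² ≤ L^{−(k−j)}ε_j(L^{k−j}η)²` — the first `≦` from the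
flow relation `ε_k ≤ (1+β₀)(k−j)^{1/2}ε_j` (as printed, `k > j`; [III] (2.8)), the second from `sqrt_mul_le_pow`
(`L ≥ 2`, `0 ≤ β₀ ≤ ½`, `ε_j ≥ 0`); `L^{−2(k−j)}` written `((L^{k−j})²)⁻¹`. [cite: Balaban1989LargeFieldI, p.199] -/
theorem chainD (n : ℕ) (hn : 1 ≤ n) {L β₀ εk εj η : ℝ} (hL : 2 ≤ L) (hβ₀ : 0 ≤ β₀) (hβ : β₀ ≤ 1 / 2)
    (hεj : 0 ≤ εj) (hflow : εk ≤ (1 + β₀) * Real.sqrt n * εj) :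
    εk * η ^ 2 ≤ (1 + β₀) * Real.sqrt n * ((L ^ n) ^ 2)⁻¹ * εj * (L ^ n * η) ^ 2 ∧
      (1 + β₀) * Real.sqrt n * ((L ^ n) ^ 2)⁻¹ * εj * (L ^ n * η) ^ 2 ≤ (L ^ n)⁻¹ * εj * (L ^ n * η) ^ 2 := by
  have hL0 : 0 < L := by linarith
  have hLn : 0 < L ^ n := pow_pos hL0 n
  have hne : L ^ n ≠ 0 := hLn.ne'
  have hunits : ((L ^ n) ^ 2)⁻¹ * (L ^ n * η) ^ 2 = η ^ 2 := by
    field_simp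
  constructor
  · calc εk * η ^ 2 ≤ (1 + β₀) * Real.sqrt n * εj * η ^ 2 := mul_le_mul_of_nonneg_right hflow (sq_nonneg η)
      _ = (1 + β₀) * Real.sqrt n * ((L ^ n) ^ 2)⁻¹ * εj * (L ^ n * η) ^ 2 := by
        rw [← hunits]; ring
  · have h1 := sqrt_mul_le_pow n hn hL hβ₀ hβ
    have hη : 0 ≤ εj * (L ^ n * η) ^ 2 := mul_nonneg hεj (sq_nonneg _)
    have h2 : (1 + β₀) * Real.sqrt n * ((L ^ n) ^ 2)⁻¹ ≤ (L ^ n)⁻¹ := by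
      have e : (L ^ n)⁻¹ = L ^ n * ((L ^ n) ^ 2)⁻¹ := by field_simp
      rw [e]
      exact mul_le_mul_of_nonneg_right h1 (inv_nonneg.mpr (sq_nonneg _))
    calc (1 + β₀) * Real.sqrt n * ((L ^ n) ^ 2)⁻¹ * εj * (L ^ n * η) ^ 2
        = (1 + β₀) * Real.sqrt n * ((L ^ n) ^ 2)⁻¹ * (εj * (L ^ n * η) ^ 2) := by ring
      _ ≤ (L ^ n)⁻¹ * (εj * (L ^ n * η) ^ 2) := mul_le_mul_of_nonneg_right h2 hη
      _ = (L ^ n)⁻¹ * εj * (L ^ n * η) ^ 2 := by ring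

end Literature.MathematicalPhysics.QuantumFieldTheory.Balaban1983to89.B15Bounds199
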